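import Mathlib
import Summits.AtomisticToContinuum.FouriersLaw.Theorems.EmbeddedDrudeMourreMourreDissolutionLevelShiftPushforward
import Summits.AtomisticToContinuum.FouriersLaw.Theorems.EmbeddedDrudeMourreFGRGapGenericA
import Summits.AtomisticToContinuum.FouriersLaw.Theorems.EmbeddedDrudeMourreFGRGapClosingA
import HarnessLib

/-!
# Evenness of the weighted two-phonon density of states — `stub_levelShiftSymmetric` (stub SYM) of line `swap-odd-threshold-rigidity`
(crux `EmbeddedDrudeMourre.MourreDissolution`, item stmt-AtomisticToContinuum-12594; helper file, `--supports`)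

Registered stub SYM of the checked skeleton of line `swap-odd-threshold-rigidity` (lead c8), in the
skeleton's stub namespace `Summit.AtomisticToContinuum.FouriersLaw.Theorems.MourreDissolution`.

Write `μ` for Lebesgue measure on the cell `(−π,π]³`, read at `p = (k₁,(k₃,k₂))` as the iterated
product `dk₁ (dk₃ dk₂)`, `W = Φ²/(ω₁ω₂ω₃ω₄)²·[f]²` for the weight of stub B0 (`Φ = vertex a b`,
`[f] = f(k₁)+f(k₂)−f(k₃)−f(k₄)`, `k₄ = k₁+k₂−k₃`, `f` continuous and `2π`-periodic) and
`Ω = ω₁+ω₂−ω₃−ω₄` for the resonance function. The claim is that the pushforward `m_f = Ω_*(W μ)`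
is invariant under `E ↦ −E`.

Proof. The swap-and-shear map `T(k₁,(k₃,k₂)) = (k₃,(k₁, k₄ mod 2π))` of the cube
* preserves `μ`: it is the composite of the shear `(k₁,(k₃,k₂)) ↦ (k₁,(k₃,(k₁+k₂−k₃) mod 2π))` — a
  skew product over the identity of `(k₁,k₃)` whose fibre maps are rotations of the circle
  `(−π,π] ≅ ℝ/2πℤ`, which preserve its Haar = Lebesgue measure (`AddCircle.measurePreserving_mk`,
  `measurePreserving_add_left`, `MeasurePreserving.skew_product`; measurability of the reduction
  `mod 2π` is `FGRGap.FoldJetRigidity.Closing.measurable_toIocMod_cell`) — with the coordinate swap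
  `k₁ ↔ k₃`, which preserves the product of three copies of one finite measure (check on boxes,
  `Measure.ext_prod₃`);
* reverses the sign of `Ω`: `Ω(k₃,k₄,k₁) = ω₃+ω₄−ω₁−ω₂` (`ω` is `2π`-periodic, so `k₄ mod 2π` may
  replace `k₄`);
* leaves `W` invariant: vertex, band product and squared bracket are symmetric under
  `(k₁,k₂) ↔ (k₃,k₄)` and `2π`-periodic in the partner slot.
Hence, on a Borel set `s`, `m_f(−s) = ∫_{Ω ∈ −s} W dμ = ∫_{T⁻¹{Ω ∈ s}} W∘T dμ = ∫_{Ω ∈ s} W dμ = m_f(s)`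
(`MeasurePreserving.setLIntegral_comp_preimage`). Pure measure theory; no cited facts.
-/

noncomputable section

namespace Summit.AtomisticToContinuum.FouriersLaw.Theorems.MourreDissolution

open MeasureTheory Set Real
open scoped ENNReal
open Literature.MathematicalPhysics.KineticTheory.PhononBoltzmann
open Summit.AtomisticToContinuum.FouriersLaw.Theorems.FGRGap.FoldJetRigidity.Generic
open Summit.AtomisticToContinuum.FouriersLaw.Theorems.FGRGap.FoldJetRigidity.Closing
  (measurable_toIocMod_cell)

/-! ### The evenness template -/

/-- Evenness template: if a measure-preserving self-map `T` of `(X, μ)` leaves the weight `W`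
invariant and reverses the sign of `Ω`, then the weighted pushforward `Ω_*(W μ)` on `ℝ` is even.
[folklore] -/
theorem levelShiftSym_map_neg_eq {X : Type*} [MeasurableSpace X] {μ : Measure X} {T : X → X}
    (hT : MeasurePreserving T μ μ) {W : X → ℝ≥0∞} (hW : Measurable W) (hWT : ∀ p, W (T p) = W p)
    {Ω : X → ℝ} (hΩ : Measurable Ω) (hΩT : ∀ p, Ω (T p) = -Ω p) :
    Measure.map (fun x : ℝ => -x) (Measure.map Ω (μ.withDensity W)) =
      Measure.map Ω (μ.withDensity W) := by
  have hneg : Measurable fun x : ℝ => -x := measurable_neg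
  ext s hs
  rw [Measure.map_apply hneg hs, Measure.map_apply hΩ (hneg hs), Measure.map_apply hΩ hs,
    withDensity_apply _ (hΩ (hneg hs)), withDensity_apply _ (hΩ hs)]
  have hset : Ω ⁻¹' ((fun x : ℝ => -x) ⁻¹' s) = T ⁻¹' (Ω ⁻¹' s) := by
    ext p
    simp only [mem_preimage, hΩT]
  rw [hset, ← hT.setLIntegral_comp_preimage (hΩ hs) hW]
  simp only [hWT]

/-! ### Rotations of the Brillouin cell preserve its measure -/

/-- Rotations of the cell `(−π, π]` (translate, then reduce mod `2π`) preserve its Lebesgue measure: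
through the measure-preserving covering map `(−π,π] → ℝ/2πℤ` and its measurable inverse section
they are the translations of the circle, which preserve its Haar measure. [folklore] -/
theorem levelShiftSym_map_rot (u v : ℝ) :
    Measure.map (fun x : ℝ => toIocMod Real.two_pi_pos (-π) (u + x - v))
      (volume.restrict (Ioc (-π) π)) = volume.restrict (Ioc (-π) π) := by
  haveI : Fact (0 < 2 * π) := ⟨Real.two_pi_pos⟩
  have hmk : Measurable ((↑) : ℝ → AddCircle (2 * π)) := AddCircle.measurable_mk'
  have he : Measurable fun y : AddCircle (2 * π) => (AddCircle.equivIoc (2 * π) (-π) y : ℝ) :=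
    measurable_subtype_coe.comp (AddCircle.measurableEquivIoc (2 * π) (-π)).measurable
  have he_mk : ∀ x : ℝ, (AddCircle.equivIoc (2 * π) (-π) (x : AddCircle (2 * π)) : ℝ) =
      toIocMod Real.two_pi_pos (-π) x := fun x => rfl
  have hadd : Measurable fun y : AddCircle (2 * π) => ((u - v : ℝ) : AddCircle (2 * π)) + y :=
    measurable_const_add _
  have hf : (fun x : ℝ => toIocMod Real.two_pi_pos (-π) (u + x - v)) =
      (fun y : AddCircle (2 * π) => (AddCircle.equivIoc (2 * π) (-π) y : ℝ)) ∘
        (fun y : AddCircle (2 * π) => ((u - v : ℝ) : AddCircle (2 * π)) + y) ∘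
          ((↑) : ℝ → AddCircle (2 * π)) := by
    funext x
    simp only [Function.comp_apply]
    rw [← AddCircle.coe_add, he_mk, show u - v + x = u + x - v by ring]
  -- the covering map `(−π, π] → ℝ/2πℤ` is measure-preserving
  have hvol : (volume : Measure (AddCircle (2 * π))) =
      (volume.restrict (Ioc (-π) π)).map ((↑) : ℝ → AddCircle (2 * π)) := by
    have h := (AddCircle.measurePreserving_mk (2 * π) (-π)).map_eq
    rw [show -π + 2 * π = π by ring] at h
    exact h.symm
  rw [hf, ← Measure.map_map he (hadd.comp hmk), ← Measure.map_map hadd hmk, ← hvol,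
    (measurePreserving_add_left volume ((u - v : ℝ) : AddCircle (2 * π))).map_eq, hvol,
    Measure.map_map he hmk]
  -- the section `ℝ/2πℤ → (−π, π]` inverts the covering map on the cell
  have hae : ((fun y : AddCircle (2 * π) => (AddCircle.equivIoc (2 * π) (-π) y : ℝ)) ∘
      ((↑) : ℝ → AddCircle (2 * π))) =ᵐ[volume.restrict (Ioc (-π) π)] id := by
    filter_upwards [ae_restrict_mem measurableSet_Ioc] with x hx
    simp only [Function.comp_apply, id]
    rw [he_mk, toIocMod_eq_self, show -π + 2 * π = π by ring]
    exact hx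
  rw [Measure.map_congr hae, Measure.map_id]

/-! ### The swap-and-shear map preserves the cell measure -/

/-- Shearing a square of the cell: for each `k₁`, the map `(k₃, k₂) ↦ (k₃, (k₁ + k₂ − k₃) mod 2π)`
preserves the product measure on `(−π,π]²` (a skew product over the identity whose fibre maps are
rotations of the cell). [folklore] -/
theorem levelShiftSym_map_shear (k₁ : ℝ) :
    Measure.map (fun q : ℝ × ℝ => (q.1, toIocMod Real.two_pi_pos (-π) (k₁ + q.2 - q.1)))
      ((volume.restrict (Ioc (-π) π)).prod (volume.restrict (Ioc (-π) π))) =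
      (volume.restrict (Ioc (-π) π)).prod (volume.restrict (Ioc (-π) π)) := by
  have h0 : Measurable fun q : ℝ × ℝ => k₁ + q.2 - q.1 := by fun_prop
  have hg : Measurable
      (Function.uncurry fun k₃ k₂ : ℝ => toIocMod Real.two_pi_pos (-π) (k₁ + k₂ - k₃)) :=
    measurable_toIocMod_cell.comp h0
  exact ((MeasurePreserving.id _).skew_product hg
    (ae_of_all _ fun k₃ => levelShiftSym_map_rot k₁ k₃)).map_eq

/-- Shearing the cube: `(k₁,(k₃,k₂)) ↦ (k₁,(k₃,(k₁ + k₂ − k₃) mod 2π))` preserves Lebesgue measure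
on `(−π,π]³` (a skew product over the identity of `k₁` with the square shears as fibre maps).
[folklore] -/
theorem levelShiftSym_measurePreserving_shear :
    MeasurePreserving (fun p : ℝ × ℝ × ℝ =>
        (p.1, (p.2.1, toIocMod Real.two_pi_pos (-π) (p.1 + p.2.2 - p.2.1))))
      ((volume.restrict (Ioc (-π) π)).prod
        ((volume.restrict (Ioc (-π) π)).prod (volume.restrict (Ioc (-π) π))))
      ((volume.restrict (Ioc (-π) π)).prod
        ((volume.restrict (Ioc (-π) π)).prod (volume.restrict (Ioc (-π) π)))) := by
  have h0 : Measurable fun p : ℝ × ℝ × ℝ => p.1 + p.2.2 - p.2.1 := by fun_prop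
  have hg : Measurable (Function.uncurry fun (k₁ : ℝ) (q : ℝ × ℝ) =>
      (q.1, toIocMod Real.two_pi_pos (-π) (k₁ + q.2 - q.1))) :=
    measurable_snd.fst.prodMk (measurable_toIocMod_cell.comp h0)
  exact (MeasurePreserving.id _).skew_product hg (ae_of_all _ fun k₁ => levelShiftSym_map_shear k₁)

/-- Swapping `k₁ ↔ k₃`: `(k₁,(k₃,k₂)) ↦ (k₃,(k₁,k₂))` preserves Lebesgue measure on `(−π,π]³` (the
three factors are one and the same finite measure; check on boxes). [folklore] -/
theorem levelShiftSym_measurePreserving_swap :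
    MeasurePreserving (fun p : ℝ × ℝ × ℝ => (p.2.1, (p.1, p.2.2)))
      ((volume.restrict (Ioc (-π) π)).prod
        ((volume.restrict (Ioc (-π) π)).prod (volume.restrict (Ioc (-π) π))))
      ((volume.restrict (Ioc (-π) π)).prod
        ((volume.restrict (Ioc (-π) π)).prod (volume.restrict (Ioc (-π) π)))) := by
  have hm : Measurable fun p : ℝ × ℝ × ℝ => (p.2.1, (p.1, p.2.2)) := by fun_prop
  refine ⟨hm, Measure.ext_prod₃ @fun s t u hs ht hu => ?_⟩
  rw [Measure.map_apply hm (hs.prod (ht.prod hu))]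
  have hpre : (fun p : ℝ × ℝ × ℝ => (p.2.1, (p.1, p.2.2))) ⁻¹' (s ×ˢ t ×ˢ u) = t ×ˢ (s ×ˢ u) := by
    ext p
    simp only [mem_preimage, mem_prod]
    tauto
  rw [hpre, Measure.prod_prod, Measure.prod_prod, Measure.prod_prod, Measure.prod_prod]
  ring

/-- The swap-and-shear map `T(k₁,(k₃,k₂)) = (k₃,(k₁,(k₁ + k₂ − k₃) mod 2π))` preserves Lebesgue
measure on `(−π,π]³`. [folklore] -/
theorem levelShiftSym_measurePreserving :
    MeasurePreserving (fun p : ℝ × ℝ × ℝ =>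
        (p.2.1, (p.1, toIocMod Real.two_pi_pos (-π) (p.1 + p.2.2 - p.2.1))))
      ((volume.restrict (Ioc (-π) π)).prod
        ((volume.restrict (Ioc (-π) π)).prod (volume.restrict (Ioc (-π) π))))
      ((volume.restrict (Ioc (-π) π)).prod
        ((volume.restrict (Ioc (-π) π)).prod (volume.restrict (Ioc (-π) π)))) :=
  levelShiftSym_measurePreserving_swap.comp levelShiftSym_measurePreserving_shear

/-! ### `Ω ∘ T = −Ω` and `W ∘ T = W` -/

/-- The vertex is symmetric under `(k₁,k₂) ↔ (k₃,k₄)`. [folklore] -/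
theorem levelShiftSym_vertex_swap (a b k₁ k₂ k₃ : ℝ) :
    vertex a b k₃ (k₁ + k₂ - k₃) k₁ = vertex a b k₁ k₂ k₃ := by
  unfold vertex
  rw [show k₃ + (k₁ + k₂ - k₃) - k₁ = k₂ by ring]
  ring

/-- The resonance function is antisymmetric under `(k₁,k₂) ↔ (k₃,k₄)`. [folklore] -/
theorem levelShiftSym_resonanceFn_swap (ω₂ k₁ k₂ k₃ : ℝ) :
    resonanceFn ω₂ k₃ (k₁ + k₂ - k₃) k₁ = -resonanceFn ω₂ k₁ k₂ k₃ := by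
  unfold resonanceFn
  rw [show k₃ + (k₁ + k₂ - k₃) - k₁ = k₂ by ring]
  ring

/-! ### The registered stub -/

/-- **Stub SYM of line `swap-odd-threshold-rigidity` (`stub_levelShiftSymmetric`).** The weighted
two-phonon density of states is even: for `ω₂ > 0`, a `2π`-periodic continuous profile `f`, the
pushforward `m_f = Ω_*(W dk)` of the weight `W = Φ²/(ω₁ω₂ω₃ω₄)²·[f]²` on the cell `(−π,π]³` (read at
`p = (k₁,(k₃,k₂))`) under the resonance function `Ω` is invariant under `E ↦ −E`. Mechanism: the
measure-preserving swap-and-shear map `T(k₁,(k₃,k₂)) = (k₃,(k₁, k₄ mod 2π))` satisfies `Ω ∘ T = −Ω`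
and `W ∘ T = W`. [folklore] -/
theorem stub_levelShiftSymmetric :
    ∀ ω₂ a b : ℝ, 0 < ω₂ → ∀ f : ℝ → ℝ, Function.Periodic f (2 * Real.pi) → Continuous f →
      MeasureTheory.Measure.map (fun x : ℝ => -x)
        (MeasureTheory.Measure.map (fun p : ℝ × ℝ × ℝ => resonanceFn ω₂ p.1 p.2.2 p.2.1)
          (((volume.restrict (Set.Ioc (-Real.pi) Real.pi)).prod
              ((volume.restrict (Set.Ioc (-Real.pi) Real.pi)).prod
                (volume.restrict (Set.Ioc (-Real.pi) Real.pi)))).withDensity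
            (fun p : ℝ × ℝ × ℝ => ENNReal.ofReal
              (vertex a b p.1 p.2.2 p.2.1 ^ 2 /
                  (dispersion ω₂ p.1 * dispersion ω₂ p.2.2 * dispersion ω₂ p.2.1 *
                    dispersion ω₂ (p.1 + p.2.2 - p.2.1)) ^ 2 *
                (f p.1 + f p.2.2 - f p.2.1 - f (p.1 + p.2.2 - p.2.1)) ^ 2)))) =
      (MeasureTheory.Measure.map (fun p : ℝ × ℝ × ℝ => resonanceFn ω₂ p.1 p.2.2 p.2.1)
          (((volume.restrict (Set.Ioc (-Real.pi) Real.pi)).prod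
              ((volume.restrict (Set.Ioc (-Real.pi) Real.pi)).prod
                (volume.restrict (Set.Ioc (-Real.pi) Real.pi)))).withDensity
            (fun p : ℝ × ℝ × ℝ => ENNReal.ofReal
              (vertex a b p.1 p.2.2 p.2.1 ^ 2 /
                  (dispersion ω₂ p.1 * dispersion ω₂ p.2.2 * dispersion ω₂ p.2.1 *
                    dispersion ω₂ (p.1 + p.2.2 - p.2.1)) ^ 2 *
                (f p.1 + f p.2.2 - f p.2.1 - f (p.1 + p.2.2 - p.2.1)) ^ 2)))) := by
  intro ω₂ a b _hω f hf hfc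
  refine levelShiftSym_map_neg_eq levelShiftSym_measurePreserving ?_ (fun p => ?_) ?_ (fun p => ?_)
  · -- `W` is measurable
    have h1 : Continuous fun p : ℝ × ℝ × ℝ => vertex a b p.1 p.2.2 p.2.1 ^ 2 := by fun_prop
    have h2 : Continuous fun p : ℝ × ℝ × ℝ => (dispersion ω₂ p.1 * dispersion ω₂ p.2.2 *
        dispersion ω₂ p.2.1 * dispersion ω₂ (p.1 + p.2.2 - p.2.1)) ^ 2 := by fun_prop
    have h3 : Continuous fun p : ℝ × ℝ × ℝ =>
        (f p.1 + f p.2.2 - f p.2.1 - f (p.1 + p.2.2 - p.2.1)) ^ 2 := by fun_prop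
    exact ((h1.measurable.div h2.measurable).mul h3.measurable).ennreal_ofReal
  · -- `W ∘ T = W`
    dsimp only
    obtain ⟨n, hn⟩ := exists_toIocMod_eq_add (-π) (p.1 + p.2.2 - p.2.1)
    rw [hn, vertex_snd_add_int_mul_two_pi,
      (dispersion_periodic ω₂).int_mul n (p.1 + p.2.2 - p.2.1),
      hf.int_mul n (p.1 + p.2.2 - p.2.1),
      show p.2.1 + (p.1 + p.2.2 - p.2.1 + n * (2 * π)) - p.1 = p.2.2 + n * (2 * π) by ring,
      (dispersion_periodic ω₂).int_mul n p.2.2, hf.int_mul n p.2.2, levelShiftSym_vertex_swap]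
    congr 1
    ring
  · -- `Ω` is measurable
    exact (by fun_prop : Continuous fun p : ℝ × ℝ × ℝ => resonanceFn ω₂ p.1 p.2.2 p.2.1).measurable
  · -- `Ω ∘ T = −Ω`
    dsimp only
    rw [resonanceFn_toIocMod_snd, levelShiftSym_resonanceFn_swap]

end Summit.AtomisticToContinuum.FouriersLaw.Theorems.MourreDissolution

end
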